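import Literature.NumberTheory.EllipticCurves.ModPReducibilityProofs
import HarnessLib

/-!
# `E[p]` is reducible when ALMOST ALL Frobenius traces are Eisenstein mod `p` — proofs

Topic `NumberTheory/EllipticCurves`; second `Proofs` companion (theorems only, nothing is defined,
no named fact) of `Literature.NumberTheory.EllipticCurves.ModPReducibility`.  The named fact
`Literature.NumberTheory.EllipticCurves.not_irreducible_of_frobeniusTrace_congr` of that file —
discharged in `ModPReducibilityProofs` (`not_irreducible_of_frobeniusTrace_congr_holds`) — asks the
Eisenstein congruence `a_ℓ(E) ≡ ℓ + 1 (mod p)` at EVERY prime `ℓ ≠ p` of good reduction.  The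
printed sources ask it only off an arbitrary finite set of primes:

* Darmon–Diamond–Taylor, *Fermat's Last Theorem* (1995), Prop. 2.6 [held copy
  `paper:doi-10-4310-cdm-1995-v1995-n1-a1`, PDF p. 53 L25–L33 and p. 54 L1–L7, read 2026-08-22]:
  "**Proposition 2.6** Let `S` be any finite set of primes. … (b) A semi-simple mod `ℓ`
  representation `ρ : G_ℚ → GL_d(k)` is determined by the values of `tr ∧^i ρ(Frob_p)`
  (`i = 1, …, d`) on the primes `p ∉ S` at which `ρ` is unramified. … *Proof:* Combining the
  Chebotarev density theorem (theorem 2.3) with the continuity of `ρ` … for mod `ℓ`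
  representations, this is the Brauer-Nesbitt theorem ([CR], (30.16))."; Prop. 2.11 (a) [PDF p. 57
  L1–L5]: "Suppose `E` has good reduction at `p`. (a) If `ℓ ≠ p`, then `ρ_{E,ℓ}` is unramified at
  `p`, and we have the formula `tr ρ_{E,ℓ}(Frob_p) = p + 1 − #Ē_p(𝔽_p)`."
* Katz, *Galois properties of torsion points on abelian varieties*, Invent. Math. 62 (1981)
  481–502, Thm. 2 (case `m = p` prime, point-count form): "if `#E(𝔽_ℓ) ≡ 0 (mod m)` for ALMOST
  ALL `ℓ` then `E` is `ℚ`-isogenous to a curve with a rational point of order `m`" (not held; cited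
  through the module docstring of `ModPReducibility`).

This file proves the corresponding strengthenings of the discharged fact, by the SAME argument as
`not_irreducible_of_frobeniusTrace_congr_holds` (Frobenius' density theorem in division form,
`exists_frobenius_pow_smul_eq_geomTorsion`, already quantifies over an arbitrary finite exceptional
set; reduction of torsion `exists_frobenius_smul_eq_of_dvd_reductionPointCount_holds`; the
invariant line of a plane all of whose automorphisms have the eigenvalue `1`,
`not_irreducible_of_forall_exists_smul_eq`):

* `not_irreducible_of_frobeniusTrace_congr_off_finite` — for any finite `S ⊆ ℕ`: if
  `p ∣ a_ℓ(E) − (ℓ + 1)` for every prime `ℓ ∉ S`, `ℓ ≠ p`, of good reduction, then `E[p]` is a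
  reducible `Γ_ℚ`-module;
* `not_irreducible_of_dvd_reductionPointCount_off_finite` — Katz's point-count form: if
  `p ∣ #Ẽ(𝔽_ℓ)` for every prime `ℓ ∉ S` of good reduction, then `E[p]` is reducible;
* `exists_prime_notMem_not_dvd_frobeniusTrace_sub` — contrapositive: `E[p]` irreducible gives,
  outside any finite `S`, a good prime `ℓ ≠ p` with `a_ℓ ≢ ℓ + 1 (mod p)` (indeed infinitely many,
  `infinite_setOf_prime_not_dvd_frobeniusTrace_sub`).

Use (cell `b2b-bsdres`, O5 lane): a curve `G` that is trace-congruent mod `p` to `E` off a finite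
set of primes and has a rational `p`-torsion point forces `a_ℓ(E) ≡ ℓ + 1` off a finite set, hence
`E[p]` reducible — so a congruent companion of a curve with irreducible `E[p]` has no rational
`p`-torsion (`Summits/BirchSwinnertonDyer/Rank1Residual/O5/CongruentCompanionTorsion.lean`).

## References

* H. Darmon, F. Diamond, R. Taylor, *Fermat's Last Theorem*, Current Developments in Mathematics
  1995, International Press, 1–154: Thm. 2.3, Prop. 2.6 (b), Prop. 2.11 (a) (PDF pp. 52–57).
  [DarmonDiamondTaylor1995]
* N. M. Katz, *Galois properties of torsion points on abelian varieties*, Invent. Math. 62 (1981)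
  481–502, Thm. 2.
* J. H. Silverman, *The Arithmetic of Elliptic Curves*, 2nd ed. (2009), Prop. VII.3.1 (b),
  Prop. VII.4.1 (a), Cor. III.6.4 (b). [SilvermanAEC2009]

## Design

Theorems only, `namespace Literature.NumberTheory.EllipticCurves`; no `def`, no named fact, no new
vocabulary; axioms of every theorem: `propext`, `Classical.choice`, `Quot.sound`.
-/

open NumberField IsDedekindDomain Field WeierstrassCurve

namespace Literature.NumberTheory.EllipticCurves

/-- **`E[p]` is reducible when the good Frobenius traces off a finite set are Eisenstein mod `p`**
(Darmon–Diamond–Taylor 1995, Prop. 2.6 (b) "Let `S` be any finite set of primes … determined by the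
values of `tr ∧^i ρ(Frob_p)` on the primes `p ∉ S` at which `ρ` is unramified", with Prop. 2.11 (a);
Katz 1981, Thm. 2, "almost all `ℓ`").  Let `E = W/ℚ` be an elliptic curve in global minimal form,
`p` a prime and `S ⊆ ℕ` finite.  If `p ∣ a_ℓ(E) − (ℓ + 1)` for every prime `ℓ ∉ S`, `ℓ ≠ p`, of good
reduction, then the `Γ_ℚ`-module `E[p]` is reducible.  Proof: every `σ ∈ Γ_ℚ` acts on `E[p]` as a
power `φ^j` of an arithmetic Frobenius `φ` above a prime `ℓ ∉ S ∪ {p} ∪ {ℓ ∣ Δ_min}` (Frobenius'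
density theorem, `exists_frobenius_pow_smul_eq_geomTorsion`), `φ` fixes a non-zero point of `E[p]`
(`p ∣ #Ẽ(𝔽_ℓ)`, reduction of torsion), hence so does `σ`; conclude by
`not_irreducible_of_forall_exists_smul_eq`.
[cite: DarmonDiamondTaylor1995, Prop. 2.6 (b) and Prop. 2.11 (a) (PDF pp. 53–54, 57)] -/
theorem not_irreducible_of_frobeniusTrace_congr_off_finite (W : WeierstrassCurve ℚ) [W.IsElliptic]
    [W.IsGloballyMinimal] (p : ℕ) [Fact p.Prime] (S : Set ℕ) (hS : S.Finite)
    (hcongr : ∀ (ℓ : ℕ) [Fact ℓ.Prime], ℓ ∉ S → ℓ ≠ p → W.HasGoodReductionAtPrime ℓ →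
      (p : ℤ) ∣ W.frobeniusTrace ℓ - (ℓ + 1)) :
    ¬ W.HasIrreducibleModPGaloisRep p := by
  classical
  have hp : p.Prime := Fact.out
  -- the excluded primes: `S`, `p` and the divisors of the minimal discriminant
  have hΔ0 : minimalDiscriminantInt W ≠ 0 := minimalDiscriminantInt_ne_zero W
  let S' : Set ℕ := S ∪ {ℓ | ℓ = p ∨ (ℓ : ℤ) ∣ minimalDiscriminantInt W}
  have hS' : S'.Finite := by
    refine hS.union ((Set.finite_le_nat (max p (minimalDiscriminantInt W).natAbs)).subset ?_)
    rintro ℓ (rfl | hℓ)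
    · exact Set.mem_setOf.mpr (le_max_left _ _)
    · exact Set.mem_setOf.mpr (le_max_of_le_right
        (Nat.le_of_dvd (Int.natAbs_pos.mpr hΔ0) (Int.natCast_dvd.mp hℓ)))
  -- every `σ ∈ Γ_ℚ` fixes a non-zero point of `E[p]`
  refine not_irreducible_of_forall_exists_smul_eq W p fun σ ↦ ?_
  obtain ⟨ℓ, v, 𝔓, φ, hℓ, hℓS', hv, h𝔓, hφ, j, hagree⟩ :=
    exists_frobenius_pow_smul_eq_geomTorsion W (n := p) (by exact_mod_cast hp.ne_zero) S' hS' σ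
  haveI : Fact ℓ.Prime := ⟨hℓ⟩
  have hℓS : ℓ ∉ S := fun h ↦ hℓS' (Or.inl h)
  have hℓp : ℓ ≠ p := fun h ↦ hℓS' (Or.inr (Or.inl h))
  have hℓΔ : ¬ (ℓ : ℤ) ∣ minimalDiscriminantInt W := fun h ↦ hℓS' (Or.inr (Or.inr h))
  have hgood : W.HasGoodReductionAtPrime ℓ := hasGoodReductionAtPrime_of_not_dvd W ℓ hℓΔ
  have hdvd : p ∣ W.reductionPointCount ℓ :=
    (dvd_frobeniusTrace_sub_iff W p ℓ).mp (hcongr ℓ hℓS hℓp hgood)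
  obtain ⟨P, hP0, hP⟩ :=
    exists_frobenius_smul_eq_of_dvd_reductionPointCount_holds W p ℓ hℓp hgood hdvd v hv 𝔓 h𝔓 φ hφ
  -- `φ • P = P`, hence `φ ^ j • P = P`, i.e. `σ • P = P`
  refine ⟨P, hP0, ?_⟩
  rw [hagree P]
  exact MulAction.mem_stabilizer_iff.mp
    (Subgroup.pow_mem (MulAction.stabilizer (absoluteGaloisGroup ℚ) P)
      (MulAction.mem_stabilizer_iff.mpr hP) j)

/-- **Katz 1981, Thm. 2 (case `m = p` prime), point-count form off a finite set**: for `E = W/ℚ` in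
global minimal form, a prime `p` and a finite `S ⊆ ℕ`, if `p ∣ #Ẽ(𝔽_ℓ)` for every prime `ℓ ∉ S` of
good reduction ("`#E(𝔽_ℓ) ≡ 0 (mod m)` for almost all `ℓ`"), then `E[p]` is a reducible
`Γ_ℚ`-module (a rational `p`-torsion point somewhere in the isogeny class, in Katz's phrasing, makes
`E[p]` reducible; only reducibility is recorded).  By `not_irreducible_of_frobeniusTrace_congr_off_finite`
and `p ∣ #Ẽ(𝔽_ℓ) ⇔ p ∣ a_ℓ − (ℓ + 1)` (`dvd_frobeniusTrace_sub_iff`).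
[cite: DarmonDiamondTaylor1995, Prop. 2.6 (b) and Prop. 2.11 (a) (PDF pp. 53–54, 57)] -/
theorem not_irreducible_of_dvd_reductionPointCount_off_finite (W : WeierstrassCurve ℚ)
    [W.IsElliptic] [W.IsGloballyMinimal] (p : ℕ) [Fact p.Prime] (S : Set ℕ) (hS : S.Finite)
    (hdvd : ∀ (ℓ : ℕ) [Fact ℓ.Prime], ℓ ∉ S → W.HasGoodReductionAtPrime ℓ →
      p ∣ W.reductionPointCount ℓ) :
    ¬ W.HasIrreducibleModPGaloisRep p :=
  not_irreducible_of_frobeniusTrace_congr_off_finite W p S hS fun ℓ _ hℓS _ hgood ↦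
    (dvd_frobeniusTrace_sub_iff W p ℓ).mpr (hdvd ℓ hℓS hgood)

/-- **A good prime off any finite set with non-Eisenstein trace, from irreducibility of `E[p]`**
(contrapositive of `not_irreducible_of_frobeniusTrace_congr_off_finite`; Darmon–Diamond–Taylor
1995, Prop. 2.6 (b)): if `E[p]` is an irreducible `Γ_ℚ`-module then outside every finite `S ⊆ ℕ`
there is a prime `ℓ ≠ p` of good reduction with `a_ℓ(E) ≢ ℓ + 1 (mod p)`, i.e. `p ∤ #Ẽ(𝔽_ℓ)`.
[cite: DarmonDiamondTaylor1995, Prop. 2.6 (b) (PDF p. 53)] -/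
theorem exists_prime_notMem_not_dvd_frobeniusTrace_sub (W : WeierstrassCurve ℚ) [W.IsElliptic]
    [W.IsGloballyMinimal] (p : ℕ) [Fact p.Prime] (hirr : W.HasIrreducibleModPGaloisRep p)
    (S : Set ℕ) (hS : S.Finite) :
    ∃ (ℓ : ℕ) (_ : Fact ℓ.Prime), ℓ ∉ S ∧ ℓ ≠ p ∧ W.HasGoodReductionAtPrime ℓ ∧
      ¬ (p : ℤ) ∣ W.frobeniusTrace ℓ - (ℓ + 1) := by
  by_contra hne
  push Not at hne
  exact not_irreducible_of_frobeniusTrace_congr_off_finite W p S hS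
    (fun ℓ _ hℓS hℓp hgood ↦ hne ℓ ‹_› hℓS hℓp hgood) hirr

/-- **Infinitely many good primes with non-Eisenstein trace, from irreducibility of `E[p]`**: if
`E[p]` is an irreducible `Γ_ℚ`-module, the set of primes `ℓ ≠ p` of good reduction with
`a_ℓ(E) ≢ ℓ + 1 (mod p)` is infinite (`exists_prime_notMem_not_dvd_frobeniusTrace_sub` applied to
every finite set; Darmon–Diamond–Taylor 1995, Prop. 2.6 (b) with the Chebotarev density theorem
2.3). [cite: DarmonDiamondTaylor1995, Prop. 2.6 (b) and Thm. 2.3 (PDF pp. 52–53)] -/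
theorem infinite_setOf_prime_not_dvd_frobeniusTrace_sub (W : WeierstrassCurve ℚ) [W.IsElliptic]
    [W.IsGloballyMinimal] (p : ℕ) [Fact p.Prime] (hirr : W.HasIrreducibleModPGaloisRep p) :
    {ℓ : ℕ | ∃ (_ : Fact ℓ.Prime), ℓ ≠ p ∧ W.HasGoodReductionAtPrime ℓ ∧
      ¬ (p : ℤ) ∣ W.frobeniusTrace ℓ - (ℓ + 1)}.Infinite := by
  intro hfin
  obtain ⟨ℓ, hℓ, hℓS, hℓp, hgood, hnot⟩ :=
    exists_prime_notMem_not_dvd_frobeniusTrace_sub W p hirr _ hfin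
  exact hℓS ⟨hℓ, hℓp, hgood, hnot⟩

end Literature.NumberTheory.EllipticCurves
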